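import Summits.AnomalousDissipation.AnomalousDissipation.Theorems.SolenoidalFractalHomogenisationLagrangianStepSidebandDefs
import HarnessLib

/-!
# K1L_D `stub_D1_exactFamily` clause (i) (`stub_D1_residue`, registry v16) — brick A1(c)-0: two BOOKKEEPING OPERATORS of the truncated sideband system
# (single-fibre states `injL`, own-fibre block generator `blockGen`) (shared definitions; reviewed; `--kind definition --supports stmt-AnomalousDissipation-27980`)

Summits-side DEFINITIONS file of route `SolenoidalFractalHomogenisation` (prover seat `ad-sawtooth-k1loc-p1` g12; variant A of D26-6/D26-7; objects of
`…SidebandDefs` only — definition of record D26-3, prover ad-k1l-cellLawV-w1 g5).  Used by `…SidebandSlot` (own-slot algebra: `gen t (injL R m u) =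
injL R m (blockGen 𝔸 γ₁ m u)` on link-invisible fibres, source / feedback on fibres) on the way to the identification `diag psiStar = excQS` (`κ = 1`,
numerically confirmed j322426) behind `WCrossing.ΨB₁` (p687442).
* `injL R z : ℂ³ →L[ℂ] Space R` — the state with amplitude `u` on the fibre `z` and `0` elsewhere (`injL_apply`, `coordL_injL_self / _of_ne`, `norm_injL`);
* `blockGen 𝔸 γ₁ m : ℂ³ →L[ℂ] ℂ³` — `u ↦ −4π² P_m T_{𝔸ᵀ}(m) P_m u − γ₁ (u − P_m u)`, the own-fibre part of `Sideband.genComp` at `z = m` (`blockGen_apply`).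
Definitions + unfolding lemmas only; no theorem of substance, no named fact, no sorry.  NOT a proof of anything; rung leaf F-D1 infrastructure.
-/

set_option linter.dupNamespace false

noncomputable section

namespace Summit.AnomalousDissipation.AnomalousDissipation.Theorems.SolenoidalFractalHomogenisation.LagrangianStep.Sideband

open Set MeasureTheory Complex
open scoped InnerProductSpace
open Literature.Analysis Literature.Analysis.FunctionSpaces Literature.Analysis.FunctionSpaces.Torus
open Literature.Analysis.FluidPDE Literature.Analysis.FluidPDE.Torus Literature.Analysis.FluidPDE.LatticeShear
open Summit.AnomalousDissipation.AnomalousDissipation.Theorems.SolenoidalFractalHomogenisation.LagrangianStep.CellChain (linkCoeff)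

variable {k₀ : ℕ}

/-! ## §1 Single-fibre states -/

/-- **The single-fibre state** `injL R z u`: amplitude `u` on the fibre `z`, `0` on every other retained lattice point (`0` altogether if `z` is not
retained). [cite: MajdaKramer1999, §2.2.1.3] -/
def injL (R : ℕ) (z : Fin 3 → ℤ) : EuclideanSpace ℂ (Fin 3) →L[ℂ] Space R :=
  ((PiLp.continuousLinearEquiv 2 ℂ (fun _ : box R => EuclideanSpace ℂ (Fin 3))).symm :
      (box R → EuclideanSpace ℂ (Fin 3)) →L[ℂ] Space R).comp
    (ContinuousLinearMap.pi fun z' : box R => if (z' : Fin 3 → ℤ) = z then ContinuousLinearMap.id ℂ _ else 0)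

/-- Components of `injL`. [cite: MajdaKramer1999, §2.2.1.3] -/
theorem injL_apply (R : ℕ) (z : Fin 3 → ℤ) (u : EuclideanSpace ℂ (Fin 3)) (z' : box R) :
    injL R z u z' = if (z' : Fin 3 → ℤ) = z then u else 0 := by
  simp only [injL, ContinuousLinearMap.comp_apply]
  split_ifs <;> simp [*]

/-- Reading the own fibre back. [cite: MajdaKramer1999, §2.2.1.3] -/
theorem coordL_injL_self {R : ℕ} {z : Fin 3 → ℤ} (hz : z ∈ box R) (u : EuclideanSpace ℂ (Fin 3)) : coordL R z (injL R z u) = u := by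
  rw [coordL_apply_of_mem hz, injL_apply, if_pos rfl]

/-- Every other fibre reads `0`. [cite: MajdaKramer1999, §2.2.1.3] -/
theorem coordL_injL_of_ne {R : ℕ} {w z : Fin 3 → ℤ} (h : w ≠ z) (u : EuclideanSpace ℂ (Fin 3)) : coordL R w (injL R z u) = 0 := by
  by_cases hw : w ∈ box R
  · rw [coordL_apply_of_mem hw, injL_apply, if_neg]; exact h
  · rw [coordL_apply_of_not_mem hw]

/-- The norm of a single-fibre state on the box is the norm of its amplitude. [cite: MajdaKramer1999, §2.2.1.3] -/
theorem norm_injL {R : ℕ} {z : Fin 3 → ℤ} (hz : z ∈ box R) (u : EuclideanSpace ℂ (Fin 3)) : ‖injL R z u‖ = ‖u‖ := by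
  classical
  have h2 : ‖injL R z u‖ ^ 2 = ‖u‖ ^ 2 := by
    rw [PiLp.norm_sq_eq_of_L2, Finset.sum_eq_single (⟨z, hz⟩ : box R)]
    · rw [injL_apply, if_pos rfl]
    · intro z' _ hz'
      have : (z' : Fin 3 → ℤ) ≠ z := fun h => hz' (Subtype.ext h)
      rw [injL_apply, if_neg this, norm_zero, zero_pow two_ne_zero]
    · intro h; exact absurd (Finset.mem_univ _) h
  have := abs_eq_abs.mpr (Or.inl rfl : ‖injL R z u‖ = ‖injL R z u‖ ∨ _)
  nlinarith [norm_nonneg (injL R z u), norm_nonneg u, sq_nonneg (‖injL R z u‖ - ‖u‖), sq_nonneg (‖injL R z u‖ + ‖u‖)]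

/-! ## §2 The block generator and the invariance of link-invisible fibres -/

/-- **The own-fibre block of the augmented generator at the wave vector `m`**: `u ↦ −4π² P_m T_{𝔸ᵀ}(m) P_m u − γ₁ (u − P_m u)` (the first two terms of
`genComp` at `z = m`). [cite: MajdaKramer1999, §2.2.1.3 (cell problem (49))] -/
def blockGen (𝔸 : Torus.Visc4 (Fin 3)) (γ₁ : ℝ) (m : Fin 3 → ℤ) : EuclideanSpace ℂ (Fin 3) →L[ℂ] EuclideanSpace ℂ (Fin 3) :=
  -((((4 * Real.pi ^ 2 : ℝ) : ℂ)) • ((transversalProj m).comp ((symbTL (Torus.majorTranspose 𝔸) m).comp (transversalProj m)))) -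
    ((γ₁ : ℝ) : ℂ) • (ContinuousLinearMap.id ℂ _ - transversalProj m)

/-- Unfolding `blockGen`. [cite: MajdaKramer1999, §2.2.1.3] -/
theorem blockGen_apply (𝔸 : Torus.Visc4 (Fin 3)) (γ₁ : ℝ) (m : Fin 3 → ℤ) (u : EuclideanSpace ℂ (Fin 3)) :
    blockGen 𝔸 γ₁ m u = -((((4 * Real.pi ^ 2 : ℝ) : ℂ)) • transversalProj m (Torus.symbT (Torus.majorTranspose 𝔸) m (transversalProj m u))) -
      ((γ₁ : ℝ) : ℂ) • (u - transversalProj m u) := by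
  simp only [blockGen, sub_apply, neg_apply, smul_apply, ContinuousLinearMap.comp_apply, symbTL_apply, ContinuousLinearMap.id_apply]

end Summit.AnomalousDissipation.AnomalousDissipation.Theorems.SolenoidalFractalHomogenisation.LagrangianStep.Sideband
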